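import Summits.Ventures.LatticeQCDFlow.Exactness.ReversibleVariationalSupTauInt
import HarnessLib

/-!
# The COMPARISON THEOREM for reversible exact samplers (Peskun–Tierney / Caracciolo–Pelissetto–Sokal), Abel form: a Dirichlet-form inequality orders the autocorrelation sums of EVERY observable

HONEST FRAMING: exact (Metropolis-corrected) sampling algorithms for lattice gauge theory;
figures of merit are autocorrelation/cost numbers at stated couplings and volumes; no
continuum-physics claim.  (SCALAR calibration rung S0-A: not a gauge result.)

Venture `LatticeQCDFlow` (cell pub-lqcd), topic `Exactness`; FANOUT row 2 (`s0-phi4`).  NEW WORK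
of the cell over `Exactness/ReversibleVariationalFloor.lean` (test-function side, Abel form) and
`Exactness/ReversibleVariationalSup.lean` (least-constant characterisation of the Abel sum), in the
format `RevOp` of a reversible exact sampler (weight `w ≥ 0`, admissible class `A` with (int) (comb),
operators with (stab) (lin) (symm) (contr)).  Only limits of real sequences; no spectral theorem, no
summability.  Nothing is cited as a fact.  Printed counterparts, NAMED ONLY: Peskun 1973 (Biometrika
60, Thm 2.1.1; finite state space — the tree's `Literature.Probability.MarkovChains.PeskunOrdering`),
Tierney 1998 (Ann. Appl. Probab. 8, Thm 4; general state space, spectral proof): off-diagonal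
domination of two reversible kernels with a common stationary law orders the asymptotic variances of
every observable; Caracciolo–Pelissetto–Sokal 1990 (J. Stat. Phys. 60) and Andrieu–Lee–Vihola 2018
(Bernoulli 24) for the version with a constant (`𝓔₁ ≥ c 𝓔₂ ⇒ v(f, P₁) ≤ c⁻¹ v(f, P₂) + (c⁻¹ − 1)
var_π f`, i.e. `τ₁ + ½ ≤ (τ₂ + ½)/c`).  The tree had the flow-sampler special case
(`Exactness/IMHTauIntModelComparison.lean`, row 4: two models at one target).  Here: EVERY pair of
reversible exact samplers of the SAME target acting on the SAME admissible class — the local arm with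
two step laws, HMC with fixed vs randomised trajectory lengths, two flows, or a lazy version of any
of them — and in ABEL form, which needs no summability.

## Setting and notation

Two operators `K`, `K'` on the class `A`, both reversible exact samplers for `w` in the `RevOp`
sense; `C(k) = ∫ g (Kᵏ g) w`, `C'(k) = ∫ g (K'ᵏ g) w` (`C(0) = C'(0) = P = ∫ g² w`); Dirichlet forms
`𝓔(v) = ∫ v² w − ∫ v (K v) w`, `𝓔'(v)` likewise; Abel sums `A_r(g) = Σ_k C(k) rᵏ`, `A'_s(g)`;
`τ_int`, `τ'_int` (`Scoring.tauInt`) when the normalised series are summable.  HYPOTHESIS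
(Dirichlet-form domination): `𝓔(v) ≤ c · 𝓔'(v)` for every `v ∈ A` — "`K'` moves at least `1/c`
times as much as `K`"; `c = 1` is Peskun's off-diagonal order `K ≤ K'` integrated.

## What is proved (namespace `RevOp`)

* **`abelSum_le_of_dirichlet_le`** (`c = 1`, PESKUN–TIERNEY IN ABEL FORM, unconditional): if
  `𝓔 ≤ 𝓔'` on `A` then for every `g ∈ A` and `0 ≤ r < 1`:  **`Σ_k C'(k) rᵏ ≤ Σ_k C(k) rᵏ`** — the
  sampler that moves more has the smaller Abel autocorrelation sum, observable by observable;
* **`abelSum_le_of_dirichlet_le_mul`** (general `c > 0`, unconditional): with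
  `s = r c/(1 − r + r c)` (again in `[0, 1)`),  **`A'_s(g) ≤ (1 − r + r c) · A_r(g)`**
  (`Q_r(v) = (1 − r)‖v‖² + r 𝓔(v) ≤ (1 − r + r c) · Q'_s(v)` and the least-constant theorem;
  as `r ↑ 1`: `s ↑ 1`, factor `→ c`);
* **`tsum_le_mul_tsum_of_dirichlet_le_mul`**, **`tauInt_add_half_le_of_dirichlet_le_mul`** —
  under the tree's standing summability hypothesis for BOTH chains (`P > 0`):
  `Σ_k C'(k) ≤ c Σ_k C(k)`, i.e. **`τ'_int + ½ ≤ c · (τ_int + ½)`**; `c = 1`: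
  **`tauInt_le_of_dirichlet_le`** — `τ'_int ≤ τ_int`;
* **`mul_abelSum_le_of_dirichlet_le_mul`** — if only `K`'s series is known summable:
  `s · A'_s(g) ≤ c · Σ_k C(k)` for every `0 < s < 1` (so `K'`'s Abel sums stay bounded: by
  `ReversibleAbelFloors` its series is either summable with `τ' + ½ ≤ c(τ + ½)` or has bounded,
  non-convergent Abel sums — never `τ' = ∞`).

The exact two-sided instance (LAZY chains: `𝓔_p = (1 − p)𝓔`, `A^{(p)}_s = A_r/(1 − s p)`) is
`Exactness/ReversibleLazyChain.lean`; lattice instances (randomised vs fixed-length HMC; the local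
arm under two step laws; pooled vs alternating flows) are separate files.  NOT CLAIMED: the converse
(ordered `τ` for every observable does not imply Dirichlet domination); non-reversible updates; any
number for any run.
-/

namespace Summit.Ventures.LatticeQCDFlow.Exactness

open Real MeasureTheory Filter Finset Topology
open Summit.Ventures.LatticeQCDFlow.Scoring

namespace RevOp

variable {X : Type*} [MeasurableSpace X] {μ : Measure X} {w : X → ℝ} {A : (X → ℝ) → Prop}
  {K K' : (X → ℝ) → (X → ℝ)}

/-! ## §1 Abel form, unconditional -/

/-- **PESKUN–TIERNEY IN ABEL FORM (unconditional).**  Two reversible exact samplers `K`, `K'` of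
the same target on the same admissible class with `𝓔(v) ≤ 𝓔'(v)` for all `v ∈ A`
(`𝓔(v) = ∫ v² w − ∫ v (K v) w`).  Then for every `g ∈ A` and `0 ≤ r < 1`:
`Σ_k C'(k) rᵏ ≤ Σ_k C(k) rᵏ` (`C(k) = ∫ g (Kᵏ g) w`, `C'(k) = ∫ g (K'ᵏ g) w`). -/
theorem abelSum_le_of_dirichlet_le (hw0 : ∀ x, 0 ≤ w x)
    (hAi : ∀ ⦃f h : X → ℝ⦄, A f → A h → Integrable (fun x => f x * h x * w x) μ)
    (hAc : ∀ ⦃f h : X → ℝ⦄ (c : ℝ), A f → A h → A (fun x => f x + c * h x))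
    (hAK : ∀ ⦃f : X → ℝ⦄, A f → A (K f))
    (hlin : ∀ ⦃f h : X → ℝ⦄ (c : ℝ), A f → A h →
      ∀ x, K (fun s => f s + c * h s) x = K f x + c * K h x)
    (hsymm : ∀ ⦃f h : X → ℝ⦄, A f → A h →
      ∫ x, K f x * h x * w x ∂μ = ∫ x, f x * K h x * w x ∂μ)
    (hcontr : ∀ ⦃f : X → ℝ⦄, A f → ∫ x, K f x ^ 2 * w x ∂μ ≤ ∫ x, f x ^ 2 * w x ∂μ)
    (hAK' : ∀ ⦃f : X → ℝ⦄, A f → A (K' f))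
    (hlin' : ∀ ⦃f h : X → ℝ⦄ (c : ℝ), A f → A h →
      ∀ x, K' (fun s => f s + c * h s) x = K' f x + c * K' h x)
    (hsymm' : ∀ ⦃f h : X → ℝ⦄, A f → A h →
      ∫ x, K' f x * h x * w x ∂μ = ∫ x, f x * K' h x * w x ∂μ)
    (hcontr' : ∀ ⦃f : X → ℝ⦄, A f → ∫ x, K' f x ^ 2 * w x ∂μ ≤ ∫ x, f x ^ 2 * w x ∂μ)
    (hdom : ∀ ⦃v : X → ℝ⦄, A v →
      (∫ x, v x ^ 2 * w x ∂μ) - ∫ x, v x * K v x * w x ∂μ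
        ≤ (∫ x, v x ^ 2 * w x ∂μ) - ∫ x, v x * K' v x * w x ∂μ)
    {g : X → ℝ} (hg : A g) {r : ℝ} (hr0 : 0 ≤ r) (hr1 : r < 1) :
    ∑' k, (∫ x, g x * (K'^[k] g) x * w x ∂μ) * r ^ k
      ≤ ∑' k, (∫ x, g x * (K^[k] g) x * w x ∂μ) * r ^ k := by
  set Ar := ∑' k, (∫ x, g x * (K^[k] g) x * w x ∂μ) * r ^ k with hAr
  have hA0 : 0 ≤ Ar := abelSum_nonneg hw0 hAi hAK hsymm hcontr hg hr0 hr1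
  refine abelSum_le_of_forall_sq_inner_le hw0 hAi hAc hAK' hlin' hsymm' hcontr' hg hr0 hr1 hA0
    fun v hv => ?_
  have h := sq_inner_le_abelSum_mul_quadForm hw0 hAi hAc hAK hlin hsymm hcontr hg hv hr0 hr1
  -- `Q_r(v) ≤ Q'_r(v)`
  have hQ : (∫ x, v x ^ 2 * w x ∂μ) - r * ∫ x, v x * K v x * w x ∂μ
      ≤ (∫ x, v x ^ 2 * w x ∂μ) - r * ∫ x, v x * K' v x * w x ∂μ := by
    have := hdom hv
    nlinarith
  exact h.trans (mul_le_mul_of_nonneg_left hQ hA0)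

/-- The reparametrisation `s = r c / (1 − r + r c)` lies in `[0, 1)` for `0 ≤ r < 1`, `0 < c`. -/
theorem compParam_mem {r c : ℝ} (hr0 : 0 ≤ r) (hr1 : r < 1) (hc : 0 < c) :
    0 < 1 - r + r * c ∧ 0 ≤ r * c / (1 - r + r * c) ∧ r * c / (1 - r + r * c) < 1 := by
  have hd : 0 < 1 - r + r * c := by nlinarith [mul_nonneg hr0 hc.le]
  refine ⟨hd, div_nonneg (mul_nonneg hr0 hc.le) hd.le, ?_⟩
  rw [div_lt_one hd]
  linarith

/-- **THE COMPARISON THEOREM WITH A CONSTANT, ABEL FORM (unconditional).**  If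
`𝓔(v) ≤ c · 𝓔'(v)` for all `v ∈ A` (`c > 0`), then for every `g ∈ A` and `0 ≤ r < 1`, with
`s = r c/(1 − r + r c)`:  `Σ_k C'(k) sᵏ ≤ (1 − r + r c) · Σ_k C(k) rᵏ`.
(`Q_r(v) = (1 − r)∫v²w + r𝓔(v) ≤ (1 − r)∫v²w + r c 𝓔'(v) = (1 − r + r c) · Q'_s(v)`.) -/
theorem abelSum_le_of_dirichlet_le_mul (hw0 : ∀ x, 0 ≤ w x)
    (hAi : ∀ ⦃f h : X → ℝ⦄, A f → A h → Integrable (fun x => f x * h x * w x) μ)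
    (hAc : ∀ ⦃f h : X → ℝ⦄ (c : ℝ), A f → A h → A (fun x => f x + c * h x))
    (hAK : ∀ ⦃f : X → ℝ⦄, A f → A (K f))
    (hlin : ∀ ⦃f h : X → ℝ⦄ (c : ℝ), A f → A h →
      ∀ x, K (fun s => f s + c * h s) x = K f x + c * K h x)
    (hsymm : ∀ ⦃f h : X → ℝ⦄, A f → A h →
      ∫ x, K f x * h x * w x ∂μ = ∫ x, f x * K h x * w x ∂μ)
    (hcontr : ∀ ⦃f : X → ℝ⦄, A f → ∫ x, K f x ^ 2 * w x ∂μ ≤ ∫ x, f x ^ 2 * w x ∂μ)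
    (hAK' : ∀ ⦃f : X → ℝ⦄, A f → A (K' f))
    (hlin' : ∀ ⦃f h : X → ℝ⦄ (c : ℝ), A f → A h →
      ∀ x, K' (fun s => f s + c * h s) x = K' f x + c * K' h x)
    (hsymm' : ∀ ⦃f h : X → ℝ⦄, A f → A h →
      ∫ x, K' f x * h x * w x ∂μ = ∫ x, f x * K' h x * w x ∂μ)
    (hcontr' : ∀ ⦃f : X → ℝ⦄, A f → ∫ x, K' f x ^ 2 * w x ∂μ ≤ ∫ x, f x ^ 2 * w x ∂μ)
    {c : ℝ} (hc : 0 < c)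
    (hdom : ∀ ⦃v : X → ℝ⦄, A v →
      (∫ x, v x ^ 2 * w x ∂μ) - ∫ x, v x * K v x * w x ∂μ
        ≤ c * ((∫ x, v x ^ 2 * w x ∂μ) - ∫ x, v x * K' v x * w x ∂μ))
    {g : X → ℝ} (hg : A g) {r : ℝ} (hr0 : 0 ≤ r) (hr1 : r < 1) :
    ∑' k, (∫ x, g x * (K'^[k] g) x * w x ∂μ) * (r * c / (1 - r + r * c)) ^ k
      ≤ (1 - r + r * c) * ∑' k, (∫ x, g x * (K^[k] g) x * w x ∂μ) * r ^ k := by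
  obtain ⟨hd, hs0, hs1⟩ := compParam_mem hr0 hr1 hc
  set s := r * c / (1 - r + r * c) with hsdef
  set Ar := ∑' k, (∫ x, g x * (K^[k] g) x * w x ∂μ) * r ^ k with hAr
  have hA0 : 0 ≤ Ar := abelSum_nonneg hw0 hAi hAK hsymm hcontr hg hr0 hr1
  refine abelSum_le_of_forall_sq_inner_le hw0 hAi hAc hAK' hlin' hsymm' hcontr' hg hs0 hs1
    (mul_nonneg hd.le hA0) fun v hv => ?_
  have h := sq_inner_le_abelSum_mul_quadForm hw0 hAi hAc hAK hlin hsymm hcontr hg hv hr0 hr1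
  have hdv := hdom hv
  -- `Q_r(v) ≤ (1 − r + r c) Q'_s(v)`
  have hsd : (1 - r + r * c) * s = r * c := by
    rw [hsdef]; field_simp
  have hQ : (∫ x, v x ^ 2 * w x ∂μ) - r * ∫ x, v x * K v x * w x ∂μ
      ≤ (1 - r + r * c) * ((∫ x, v x ^ 2 * w x ∂μ) - s * ∫ x, v x * K' v x * w x ∂μ) := by
    have e : (1 - r + r * c) * ((∫ x, v x ^ 2 * w x ∂μ) - s * ∫ x, v x * K' v x * w x ∂μ)
        = (1 - r) * (∫ x, v x ^ 2 * w x ∂μ)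
          + r * (c * ((∫ x, v x ^ 2 * w x ∂μ) - ∫ x, v x * K' v x * w x ∂μ)) := by
      have : (1 - r + r * c) * (s * ∫ x, v x * K' v x * w x ∂μ)
          = r * c * ∫ x, v x * K' v x * w x ∂μ := by rw [← mul_assoc, hsd]
      rw [mul_sub, this]
      ring
    rw [e]
    nlinarith
  calc (∫ x, g x * v x * w x ∂μ) ^ 2
      ≤ Ar * ((∫ x, v x ^ 2 * w x ∂μ) - r * ∫ x, v x * K v x * w x ∂μ) := h
    _ ≤ Ar * ((1 - r + r * c) * ((∫ x, v x ^ 2 * w x ∂μ) - s * ∫ x, v x * K' v x * w x ∂μ)) :=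
        mul_le_mul_of_nonneg_left hQ hA0
    _ = (1 - r + r * c) * Ar * ((∫ x, v x ^ 2 * w x ∂μ) - s * ∫ x, v x * K' v x * w x ∂μ) := by
        ring

/-! ## §2 Under summability: `τ'_int + ½ ≤ c (τ_int + ½)` -/

/-- **`Σ_k C'(k) ≤ c · Σ_k C(k)`** when `𝓔 ≤ c 𝓔'` on `A` and BOTH autocovariance series are summable
(the `r = 1` least-constant theorem for `K'` fed with the `r = 1` variational floor of `K`). -/
theorem tsum_le_mul_tsum_of_dirichlet_le_mul (hw0 : ∀ x, 0 ≤ w x)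
    (hAi : ∀ ⦃f h : X → ℝ⦄, A f → A h → Integrable (fun x => f x * h x * w x) μ)
    (hAc : ∀ ⦃f h : X → ℝ⦄ (c : ℝ), A f → A h → A (fun x => f x + c * h x))
    (hAK : ∀ ⦃f : X → ℝ⦄, A f → A (K f))
    (hlin : ∀ ⦃f h : X → ℝ⦄ (c : ℝ), A f → A h →
      ∀ x, K (fun s => f s + c * h s) x = K f x + c * K h x)
    (hsymm : ∀ ⦃f h : X → ℝ⦄, A f → A h →
      ∫ x, K f x * h x * w x ∂μ = ∫ x, f x * K h x * w x ∂μ)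
    (hcontr : ∀ ⦃f : X → ℝ⦄, A f → ∫ x, K f x ^ 2 * w x ∂μ ≤ ∫ x, f x ^ 2 * w x ∂μ)
    (hAK' : ∀ ⦃f : X → ℝ⦄, A f → A (K' f))
    (hlin' : ∀ ⦃f h : X → ℝ⦄ (c : ℝ), A f → A h →
      ∀ x, K' (fun s => f s + c * h s) x = K' f x + c * K' h x)
    (hsymm' : ∀ ⦃f h : X → ℝ⦄, A f → A h →
      ∫ x, K' f x * h x * w x ∂μ = ∫ x, f x * K' h x * w x ∂μ)
    {c : ℝ} (hc : 0 < c)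
    (hdom : ∀ ⦃v : X → ℝ⦄, A v →
      (∫ x, v x ^ 2 * w x ∂μ) - ∫ x, v x * K v x * w x ∂μ
        ≤ c * ((∫ x, v x ^ 2 * w x ∂μ) - ∫ x, v x * K' v x * w x ∂μ))
    {g : X → ℝ} (hg : A g) (hP : 0 < ∫ x, g x ^ 2 * w x ∂μ)
    (hs : Summable fun n => (∫ x, g x * (K^[n + 1] g) x * w x ∂μ) / ∫ x, g x ^ 2 * w x ∂μ)
    (hs' : Summable fun n => (∫ x, g x * (K'^[n + 1] g) x * w x ∂μ) / ∫ x, g x ^ 2 * w x ∂μ) :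
    ∑' k, ∫ x, g x * (K'^[k] g) x * w x ∂μ ≤ c * ∑' k, ∫ x, g x * (K^[k] g) x * w x ∂μ := by
  set C : ℕ → ℝ := fun k => ∫ x, g x * (K^[k] g) x * w x ∂μ with hC
  set C' : ℕ → ℝ := fun k => ∫ x, g x * (K'^[k] g) x * w x ∂μ with hC'
  set P := ∫ x, g x ^ 2 * w x ∂μ with hPdef
  have hsρ : Summable fun k => C k / P := (summable_nat_add_iff 1).1 hs
  have hsC : Summable C := (hsρ.mul_left P).congr fun k => by field_simp
  have hsρ' : Summable fun k => C' k / P := (summable_nat_add_iff 1).1 hs'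
  have hsC' : Summable C' := (hsρ'.mul_left P).congr fun k => by field_simp
  have hdiv : (∑' k, C k / P) = (∑' k, C k) / P := tsum_div_const
  -- `Σ C ≥ 0`
  have hC0 : C 0 = P := by
    simp only [hC, hPdef, Function.iterate_zero, id_eq]
    exact integral_congr_ae (Eventually.of_forall fun x => by ring)
  have hT0 : 0 ≤ ∑' k, C k := by
    have h1 : ∑' k, C k / P = tauInt (fun n => C n / P) + 1 / 2 := by
      rw [hsρ.tsum_eq_zero_add, hC0, div_self hP.ne']
      simp only [tauInt]
      ring
    have h2 := tauInt_ge_neg_half hw0 hAi hAK hsymm hcontr hg hs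
    have h3 : 0 ≤ (∑' k, C k) / P := by rw [← hdiv, h1]; linarith
    exact (div_nonneg_iff.1 h3).elim (fun h => h.1) fun h => absurd h.2 (not_le.2 hP)
  refine tsum_le_of_forall_sq_inner_le_dirichlet hAi hAc hAK' hlin' hsymm' hg hsC'
    (mul_nonneg hc.le hT0) fun v hv => ?_
  have h := sq_inner_le_tsum_mul_dirichlet hw0 hAi hAc hAK hlin hsymm hcontr hg hv hs
  rw [hdiv, ← hPdef, ← mul_assoc, mul_div_cancel₀ _ hP.ne'] at h
  calc (∫ x, g x * v x * w x ∂μ) ^ 2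
      ≤ (∑' k, C k) * ((∫ x, v x ^ 2 * w x ∂μ) - ∫ x, v x * K v x * w x ∂μ) := h
    _ ≤ (∑' k, C k) * (c * ((∫ x, v x ^ 2 * w x ∂μ) - ∫ x, v x * K' v x * w x ∂μ)) :=
        mul_le_mul_of_nonneg_left (hdom hv) hT0
    _ = c * (∑' k, C k) * ((∫ x, v x ^ 2 * w x ∂μ) - ∫ x, v x * K' v x * w x ∂μ) := by ring

/-- **THE COMPARISON THEOREM FOR `τ_int`.**  `𝓔 ≤ c 𝓔'` on `A` (`c > 0`), `g ∈ A` with `P > 0` and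
both normalised autocorrelation series summable:  `τ'_int(g) + ½ ≤ c · (τ_int(g) + ½)`. -/
theorem tauInt_add_half_le_of_dirichlet_le_mul (hw0 : ∀ x, 0 ≤ w x)
    (hAi : ∀ ⦃f h : X → ℝ⦄, A f → A h → Integrable (fun x => f x * h x * w x) μ)
    (hAc : ∀ ⦃f h : X → ℝ⦄ (c : ℝ), A f → A h → A (fun x => f x + c * h x))
    (hAK : ∀ ⦃f : X → ℝ⦄, A f → A (K f))
    (hlin : ∀ ⦃f h : X → ℝ⦄ (c : ℝ), A f → A h →
      ∀ x, K (fun s => f s + c * h s) x = K f x + c * K h x)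
    (hsymm : ∀ ⦃f h : X → ℝ⦄, A f → A h →
      ∫ x, K f x * h x * w x ∂μ = ∫ x, f x * K h x * w x ∂μ)
    (hcontr : ∀ ⦃f : X → ℝ⦄, A f → ∫ x, K f x ^ 2 * w x ∂μ ≤ ∫ x, f x ^ 2 * w x ∂μ)
    (hAK' : ∀ ⦃f : X → ℝ⦄, A f → A (K' f))
    (hlin' : ∀ ⦃f h : X → ℝ⦄ (c : ℝ), A f → A h →
      ∀ x, K' (fun s => f s + c * h s) x = K' f x + c * K' h x)
    (hsymm' : ∀ ⦃f h : X → ℝ⦄, A f → A h →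
      ∫ x, K' f x * h x * w x ∂μ = ∫ x, f x * K' h x * w x ∂μ)
    {c : ℝ} (hc : 0 < c)
    (hdom : ∀ ⦃v : X → ℝ⦄, A v →
      (∫ x, v x ^ 2 * w x ∂μ) - ∫ x, v x * K v x * w x ∂μ
        ≤ c * ((∫ x, v x ^ 2 * w x ∂μ) - ∫ x, v x * K' v x * w x ∂μ))
    {g : X → ℝ} (hg : A g) (hP : 0 < ∫ x, g x ^ 2 * w x ∂μ)
    (hs : Summable fun n => (∫ x, g x * (K^[n + 1] g) x * w x ∂μ) / ∫ x, g x ^ 2 * w x ∂μ)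
    (hs' : Summable fun n => (∫ x, g x * (K'^[n + 1] g) x * w x ∂μ) / ∫ x, g x ^ 2 * w x ∂μ) :
    tauInt (fun n => (∫ x, g x * (K'^[n] g) x * w x ∂μ) / ∫ x, g x ^ 2 * w x ∂μ) + 1 / 2
      ≤ c * (tauInt (fun n => (∫ x, g x * (K^[n] g) x * w x ∂μ) / ∫ x, g x ^ 2 * w x ∂μ)
        + 1 / 2) := by
  set C : ℕ → ℝ := fun k => ∫ x, g x * (K^[k] g) x * w x ∂μ with hC
  set C' : ℕ → ℝ := fun k => ∫ x, g x * (K'^[k] g) x * w x ∂μ with hC'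
  set P := ∫ x, g x ^ 2 * w x ∂μ with hPdef
  have hmain := tsum_le_mul_tsum_of_dirichlet_le_mul hw0 hAi hAc hAK hlin hsymm hcontr hAK' hlin'
    hsymm' hc hdom hg hP hs hs'
  have hsρ : Summable fun k => C k / P := (summable_nat_add_iff 1).1 hs
  have hsρ' : Summable fun k => C' k / P := (summable_nat_add_iff 1).1 hs'
  have hC0 : C 0 = P := by
    simp only [hC, hPdef, Function.iterate_zero, id_eq]
    exact integral_congr_ae (Eventually.of_forall fun x => by ring)
  have hC0' : C' 0 = P := by
    simp only [hC', hPdef, Function.iterate_zero, id_eq]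
    exact integral_congr_ae (Eventually.of_forall fun x => by ring)
  have h1 : (∑' k, C k) / P = tauInt (fun n => C n / P) + 1 / 2 := by
    rw [← tsum_div_const, hsρ.tsum_eq_zero_add, hC0, div_self hP.ne']
    simp only [tauInt]
    ring
  have h1' : (∑' k, C' k) / P = tauInt (fun n => C' n / P) + 1 / 2 := by
    rw [← tsum_div_const, hsρ'.tsum_eq_zero_add, hC0', div_self hP.ne']
    simp only [tauInt]
    ring
  rw [← h1, ← h1', mul_div_assoc', div_le_div_iff_of_pos_right hP]
  exact hmain

/-- **PESKUN–TIERNEY FOR `τ_int`** (`c = 1`): `𝓔 ≤ 𝓔'` on `A`, `P > 0`, both series summable ⇒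
`τ'_int(g) ≤ τ_int(g)` — the sampler that moves more has the smaller integrated autocorrelation
time, for every observable in the class. -/
theorem tauInt_le_of_dirichlet_le (hw0 : ∀ x, 0 ≤ w x)
    (hAi : ∀ ⦃f h : X → ℝ⦄, A f → A h → Integrable (fun x => f x * h x * w x) μ)
    (hAc : ∀ ⦃f h : X → ℝ⦄ (c : ℝ), A f → A h → A (fun x => f x + c * h x))
    (hAK : ∀ ⦃f : X → ℝ⦄, A f → A (K f))
    (hlin : ∀ ⦃f h : X → ℝ⦄ (c : ℝ), A f → A h →
      ∀ x, K (fun s => f s + c * h s) x = K f x + c * K h x)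
    (hsymm : ∀ ⦃f h : X → ℝ⦄, A f → A h →
      ∫ x, K f x * h x * w x ∂μ = ∫ x, f x * K h x * w x ∂μ)
    (hcontr : ∀ ⦃f : X → ℝ⦄, A f → ∫ x, K f x ^ 2 * w x ∂μ ≤ ∫ x, f x ^ 2 * w x ∂μ)
    (hAK' : ∀ ⦃f : X → ℝ⦄, A f → A (K' f))
    (hlin' : ∀ ⦃f h : X → ℝ⦄ (c : ℝ), A f → A h →
      ∀ x, K' (fun s => f s + c * h s) x = K' f x + c * K' h x)
    (hsymm' : ∀ ⦃f h : X → ℝ⦄, A f → A h →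
      ∫ x, K' f x * h x * w x ∂μ = ∫ x, f x * K' h x * w x ∂μ)
    (hdom : ∀ ⦃v : X → ℝ⦄, A v →
      (∫ x, v x ^ 2 * w x ∂μ) - ∫ x, v x * K v x * w x ∂μ
        ≤ (∫ x, v x ^ 2 * w x ∂μ) - ∫ x, v x * K' v x * w x ∂μ)
    {g : X → ℝ} (hg : A g) (hP : 0 < ∫ x, g x ^ 2 * w x ∂μ)
    (hs : Summable fun n => (∫ x, g x * (K^[n + 1] g) x * w x ∂μ) / ∫ x, g x ^ 2 * w x ∂μ)
    (hs' : Summable fun n => (∫ x, g x * (K'^[n + 1] g) x * w x ∂μ) / ∫ x, g x ^ 2 * w x ∂μ) :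
    tauInt (fun n => (∫ x, g x * (K'^[n] g) x * w x ∂μ) / ∫ x, g x ^ 2 * w x ∂μ)
      ≤ tauInt (fun n => (∫ x, g x * (K^[n] g) x * w x ∂μ) / ∫ x, g x ^ 2 * w x ∂μ) := by
  have h := tauInt_add_half_le_of_dirichlet_le_mul hw0 hAi hAc hAK hlin hsymm hcontr hAK' hlin'
    hsymm' one_pos (fun v hv => by rw [one_mul]; exact hdom hv) hg hP hs hs'
  linarith

/-! ## §3 When only the dominated chain is known summable -/

/-- **`s · A'_s(g) ≤ c · Σ_k C(k)`** for every `0 < s < 1`, when `𝓔 ≤ c 𝓔'` on `A` and the series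
of the DOMINATED sampler `K` is summable (`P > 0`): the Abel sums of `K'` stay bounded
(`Q'_s(v) ≥ s 𝓔'(v)` and the least-constant theorem).  By `ReversibleAbelFloors` the alternative
"`τ' = ∞` with unbounded Abel sums" is thereby excluded for `K'`. -/
theorem mul_abelSum_le_of_dirichlet_le_mul (hw0 : ∀ x, 0 ≤ w x)
    (hAi : ∀ ⦃f h : X → ℝ⦄, A f → A h → Integrable (fun x => f x * h x * w x) μ)
    (hAc : ∀ ⦃f h : X → ℝ⦄ (c : ℝ), A f → A h → A (fun x => f x + c * h x))
    (hAK : ∀ ⦃f : X → ℝ⦄, A f → A (K f))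
    (hlin : ∀ ⦃f h : X → ℝ⦄ (c : ℝ), A f → A h →
      ∀ x, K (fun s => f s + c * h s) x = K f x + c * K h x)
    (hsymm : ∀ ⦃f h : X → ℝ⦄, A f → A h →
      ∫ x, K f x * h x * w x ∂μ = ∫ x, f x * K h x * w x ∂μ)
    (hcontr : ∀ ⦃f : X → ℝ⦄, A f → ∫ x, K f x ^ 2 * w x ∂μ ≤ ∫ x, f x ^ 2 * w x ∂μ)
    (hAK' : ∀ ⦃f : X → ℝ⦄, A f → A (K' f))
    (hlin' : ∀ ⦃f h : X → ℝ⦄ (c : ℝ), A f → A h →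
      ∀ x, K' (fun s => f s + c * h s) x = K' f x + c * K' h x)
    (hsymm' : ∀ ⦃f h : X → ℝ⦄, A f → A h →
      ∫ x, K' f x * h x * w x ∂μ = ∫ x, f x * K' h x * w x ∂μ)
    (hcontr' : ∀ ⦃f : X → ℝ⦄, A f → ∫ x, K' f x ^ 2 * w x ∂μ ≤ ∫ x, f x ^ 2 * w x ∂μ)
    {c : ℝ} (hc : 0 < c)
    (hdom : ∀ ⦃v : X → ℝ⦄, A v →
      (∫ x, v x ^ 2 * w x ∂μ) - ∫ x, v x * K v x * w x ∂μ
        ≤ c * ((∫ x, v x ^ 2 * w x ∂μ) - ∫ x, v x * K' v x * w x ∂μ))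
    {g : X → ℝ} (hg : A g) (hP : 0 < ∫ x, g x ^ 2 * w x ∂μ)
    (hs : Summable fun n => (∫ x, g x * (K^[n + 1] g) x * w x ∂μ) / ∫ x, g x ^ 2 * w x ∂μ)
    {s : ℝ} (hs0 : 0 < s) (hs1 : s < 1) :
    s * ∑' k, (∫ x, g x * (K'^[k] g) x * w x ∂μ) * s ^ k
      ≤ c * ∑' k, ∫ x, g x * (K^[k] g) x * w x ∂μ := by
  set C : ℕ → ℝ := fun k => ∫ x, g x * (K^[k] g) x * w x ∂μ with hC
  set P := ∫ x, g x ^ 2 * w x ∂μ with hPdef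
  have hsρ : Summable fun k => C k / P := (summable_nat_add_iff 1).1 hs
  have hdiv : (∑' k, C k / P) = (∑' k, C k) / P := tsum_div_const
  have hC0 : C 0 = P := by
    simp only [hC, hPdef, Function.iterate_zero, id_eq]
    exact integral_congr_ae (Eventually.of_forall fun x => by ring)
  have hT0 : 0 ≤ ∑' k, C k := by
    have h1 : ∑' k, C k / P = tauInt (fun n => C n / P) + 1 / 2 := by
      rw [hsρ.tsum_eq_zero_add, hC0, div_self hP.ne']
      simp only [tauInt]
      ring
    have h2 := tauInt_ge_neg_half hw0 hAi hAK hsymm hcontr hg hs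
    have h3 : 0 ≤ (∑' k, C k) / P := by rw [← hdiv, h1]; linarith
    exact (div_nonneg_iff.1 h3).elim (fun h => h.1) fun h => absurd h.2 (not_le.2 hP)
  -- least constant `B = c Σ C / s` for `K'` at parameter `s`
  have hB : 0 ≤ c * (∑' k, C k) / s := div_nonneg (mul_nonneg hc.le hT0) hs0.le
  have hle := abelSum_le_of_forall_sq_inner_le hw0 hAi hAc hAK' hlin' hsymm' hcontr' hg hs0.le hs1
    hB (fun v hv => by
      have h := sq_inner_le_tsum_mul_dirichlet hw0 hAi hAc hAK hlin hsymm hcontr hg hv hs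
      rw [hdiv, ← hPdef, ← mul_assoc, mul_div_cancel₀ _ hP.ne'] at h
      have hE' : 0 ≤ (∫ x, v x ^ 2 * w x ∂μ) - ∫ x, v x * K' v x * w x ∂μ := by
        have := quadForm_nonneg hw0 hAi hAK' hcontr' hv zero_le_one le_rfl
        rw [one_mul] at this
        exact this
      have hv2 : 0 ≤ ∫ x, v x ^ 2 * w x ∂μ :=
        integral_nonneg fun x => mul_nonneg (sq_nonneg _) (hw0 x)
      -- `𝓔'(v) ≤ Q'_s(v)/s`
      have hQ : (∫ x, v x ^ 2 * w x ∂μ) - ∫ x, v x * K' v x * w x ∂μ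
          ≤ ((∫ x, v x ^ 2 * w x ∂μ) - s * ∫ x, v x * K' v x * w x ∂μ) / s := by
        rw [le_div_iff₀ hs0]
        nlinarith
      calc (∫ x, g x * v x * w x ∂μ) ^ 2
          ≤ (∑' k, C k) * ((∫ x, v x ^ 2 * w x ∂μ) - ∫ x, v x * K v x * w x ∂μ) := h
        _ ≤ (∑' k, C k) * (c * ((∫ x, v x ^ 2 * w x ∂μ) - ∫ x, v x * K' v x * w x ∂μ)) :=
            mul_le_mul_of_nonneg_left (hdom hv) hT0
        _ ≤ (∑' k, C k) * (c * (((∫ x, v x ^ 2 * w x ∂μ) - s * ∫ x, v x * K' v x * w x ∂μ) / s)) :=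
            mul_le_mul_of_nonneg_left (mul_le_mul_of_nonneg_left hQ hc.le) hT0
        _ = c * (∑' k, C k) / s
            * ((∫ x, v x ^ 2 * w x ∂μ) - s * ∫ x, v x * K' v x * w x ∂μ) := by
            field_simp)
  calc s * ∑' k, (∫ x, g x * (K'^[k] g) x * w x ∂μ) * s ^ k ≤ s * (c * (∑' k, C k) / s) :=
        mul_le_mul_of_nonneg_left hle hs0.le
    _ = c * ∑' k, C k := by field_simp

end RevOp

end Summit.Ventures.LatticeQCDFlow.Exactness
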